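import Literature.AlgebraicGeometry.Motives.EtaleBijectiveIso
import Literature.Topology.CoveringSpaces.SectionOfPullbackCovering
import Literature.Topology.NoetherianSpaces.NoetherianConnectedComponent
import Literature.NumberTheory.Transcendental.AnalytificationConnectedProofs
import Literature.NumberTheory.Transcendental.AnalytificationProper
import HarnessLib

/-!
# Continuous lifts through étale covers are algebraic

Let `f : C ⟶ S` and `g : Y ⟶ S` be morphisms of `ℂ`-schemes locally of finite type, `S` separated,
`g` étale and `g(ℂ) : Y(ℂ) → S(ℂ)` locally injective (e.g. a covering map), `Y(ℂ)` Hausdorff, `C(ℂ)`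
connected and non-empty, and `C ×_S Y` Noetherian. If `F : C(ℂ) → Y(ℂ)` is a **continuous** map with
`g(ℂ) ∘ F = f(ℂ)` — a continuous lift of `f(ℂ)` through `g(ℂ)` — then `F = e(ℂ)` for a morphism of
`ℂ`-schemes `e : C ⟶ Y` with `e ≫ g = f` (`exists_hom_comp_eq_and_map_eq`).

This is the elementary case of the Riemann existence theorem / GAGA for étale covers (SGA1 XII
Thm. 5.1, Cor. 5.2: `X ↦ X^an` is fully faithful on finite étale covers) that is needed to feed the
universal property of the Jacobian with a topologically constructed lift (towards
`Literature.AlgebraicGeometry.Motives.isIso_bettiCohomology_map_abelJacobi`). Proof: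

1. In `C''' = C ×_S Y` the graph `T = {R | pr₂ R = F (pr₁ R)}` of `F` is clopen in `C'''(ℂ)` (the
   embedding `C'''(ℂ) ↪ C(ℂ) × Y(ℂ)`, `pullbackOver.isEmbedding_points`, and
   `isClopen_preimage_setOf_snd_eq_lift`) and connected (it is the image of the continuous section
   `x ↦ (x, F x)`).
2. The connected component `U` of `C'''` through a point of `T` is clopen (`C'''` Noetherian,
   `isClopen_connectedComponent_of_noetherianSpace`), the complex points of the open subscheme
   `Z = C'''|_U` form the clopen connected set `V = {R | R.pt ∈ U}` (SGA1 XII Prop. 2.4 for `Z`,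
   the tree's `ComplexPoints.connectedSpace_iff_holds`), and `T = V` (two clopen connected sets
   sharing a point).
3. `Z ⟶ C''' ⟶ C` is étale and bijective on complex points, hence an isomorphism
   (`isIso_of_etale_of_bijective_map`); `e` is its inverse followed by `Z ⟶ C''' ⟶ Y`.

Everything is proved; no definitions.

## References

* A. Grothendieck, SGA1, Exp. XII, Prop. 2.4, Thm. 5.1, Cor. 5.2. [SGA1]
-/

noncomputable section

open CategoryTheory CategoryTheory.Limits AlgebraicGeometry Topology
open Literature.Topology.CoveringSpaces Literature.Topology.NoetherianSpaces

namespace Literature.AlgebraicGeometry.Motives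

variable {C Y S : SchemeOver ℂ} (f : C ⟶ S) (g : Y ⟶ S)

/-- **Continuous lifts through étale covers are algebraic.** With the hypotheses of the module
docstring: a continuous `F : C(ℂ) → Y(ℂ)` with `g(ℂ) ∘ F = f(ℂ)` is `e(ℂ)` for a `ℂ`-morphism
`e : C ⟶ Y` with `e ≫ g = f`. [cite: SGA1, Exp. XII Thm. 5.1 and Cor. 5.2] -/
theorem exists_hom_comp_eq_and_map_eq [LocallyOfFiniteType C.hom] [LocallyOfFiniteType Y.hom]
    [LocallyOfFiniteType S.hom] [IsSeparated S.hom] [Etale g.left]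
    [ConnectedSpace (ComplexPoints C)] [Nonempty (ComplexPoints C)] [T2Space (ComplexPoints Y)]
    [TopologicalSpace.NoetherianSpace ↥(pullback f.left g.left)]
    (hg : IsLocallyInjective (AlgPoints.map (L := ℂ) g)) (F : C(ComplexPoints C, ComplexPoints Y))
    (hF : ∀ x, AlgPoints.map g (F x) = AlgPoints.map f x) :
    ∃ e : C ⟶ Y, e ≫ g = f ∧ ∀ x, AlgPoints.map (L := ℂ) e x = F x := by
  -- the fibre product `C''' = C ×_S Y`, its complex points `ι : C'''(ℂ) ↪ C(ℂ) × Y(ℂ)`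
  set P3 := pullbackOver f g with hP3
  let ι : ComplexPoints P3 → ComplexPoints C × ComplexPoints Y := fun R =>
    ((pullbackOver.pointsEquiv f g ℂ R).1 : ComplexPoints C × ComplexPoints Y)
  have hιemb : IsEmbedding ι := pullbackOver.isEmbedding_points f g ℂ
  have hι : ∀ R, AlgPoints.map f (ι R).1 = AlgPoints.map g (ι R).2 := fun R =>
    (pullbackOver.pointsEquiv f g ℂ R).2
  -- the section `s` and its image `T`, the graph of `F`
  let s : ComplexPoints C → ComplexPoints P3 := fun x =>
    (pullbackOver.pointsEquiv f g ℂ).symm ⟨(x, F x), (hF x).symm⟩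
  have hιs : ∀ x, ι (s x) = (x, F x) := fun x =>
    congrArg Subtype.val ((pullbackOver.pointsEquiv f g ℂ).apply_symm_apply ⟨(x, F x), (hF x).symm⟩)
  have hs : Continuous s := by
    rw [hιemb.continuous_iff]
    have : ι ∘ s = fun x => (x, F x) := funext hιs
    rw [this]
    exact continuous_id.prodMk F.continuous
  set T : Set (ComplexPoints P3) := {R | (ι R).2 = F (ι R).1} with hT
  have hTclopen : IsClopen T :=
    isClopen_preimage_setOf_snd_eq_lift (AlgPoints.map (L := ℂ) f) (AlgPoints.map (L := ℂ) g) F hg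
      F.continuous hF ι hι hιemb.continuous
  have hTrange : T = Set.range s := by
    ext R
    constructor
    · intro hR
      refine ⟨(ι R).1, hιemb.injective ?_⟩
      rw [hιs]
      exact Prod.ext rfl hR.symm
    · rintro ⟨x, rfl⟩
      change (ι (s x)).2 = F (ι (s x)).1
      rw [hιs]
  have hTconn : IsConnected T := by
    rw [hTrange]
    exact isConnected_range hs
  -- a base point
  obtain ⟨x₀⟩ : Nonempty (ComplexPoints C) := inferInstance
  have hR₀T : s x₀ ∈ T := by rw [hTrange]; exact ⟨x₀, rfl⟩
  -- the connected component `U` of `C'''` through `(s x₀).pt`: clopen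
  let U : P3.left.Opens := ⟨connectedComponent (s x₀).pt,
    isOpen_connectedComponent_of_noetherianSpace (X := ↥(pullback f.left g.left)) _⟩
  -- the open subscheme `Z = C'''|_U` over `ℂ` and `zι : Z ⟶ C'''`
  let Z : SchemeOver ℂ := Over.mk (U.ι ≫ P3.hom)
  let zι : Z ⟶ P3 := Over.homMk U.ι rfl
  haveI : IsOpenImmersion zι.left := inferInstanceAs (IsOpenImmersion U.ι)
  haveI : LocallyOfFiniteType P3.hom := by
    change LocallyOfFiniteType (pullback.fst f.left g.left ≫ C.hom)
    infer_instance
  haveI : LocallyOfFiniteType Z.hom := by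
    change LocallyOfFiniteType (U.ι ≫ P3.hom)
    infer_instance
  haveI : ConnectedSpace ↥Z.left := by
    change ConnectedSpace ↥U
    exact isConnected_iff_connectedSpace.mp isConnected_connectedComponent
  haveI : ConnectedSpace (ComplexPoints Z) :=
    (ComplexPoints.connectedSpace_iff_holds Z).mpr inferInstance
  -- its complex points `V = {R | R.pt ∈ U}`: clopen and connected
  set V : Set (ComplexPoints P3) := {R | R.pt ∈ (U : Set P3.left)} with hV
  have hVrange : Set.range (AlgPoints.map (L := ℂ) zι) = V := by
    rw [AlgPoints.range_map_of_isOpenImmersion_holds zι]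
    ext R
    change R.pt ∈ (zι.left.opensRange : Set P3.left) ↔ R.pt ∈ (U : Set P3.left)
    rw [show (zι.left.opensRange : Set P3.left) = (U : Set P3.left) from
      congrArg SetLike.coe U.opensRange_ι]
  have hVclopen : IsClopen V :=
    (isClopen_connectedComponent_of_noetherianSpace (X := ↥(pullback f.left g.left)) _).preimage
      AlgPoints.continuous_pt
  have hVconn : IsConnected V := by
    rw [← hVrange]
    exact isConnected_range (AlgPoints.continuous_map zι)
  have hR₀V : s x₀ ∈ V := mem_connectedComponent
  -- `T = V`
  have hTV : T = V :=
    Set.Subset.antisymm (hTconn.isPreconnected.subset_isClopen hVclopen ⟨s x₀, hR₀T, hR₀V⟩)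
      (hVconn.isPreconnected.subset_isClopen hTclopen ⟨s x₀, hR₀V, hR₀T⟩)
  -- `p_Z : Z ⟶ C` is étale and bijective on complex points, hence an isomorphism
  let pZ : Z ⟶ C := zι ≫ pullbackOver.fst f g
  haveI h1 : Etale (pullback.fst f.left g.left) :=
    MorphismProperty.pullback_fst (P := @Etale) f.left g.left ‹Etale g.left›
  haveI h2 : Etale U.ι := inferInstance
  haveI : Etale pZ.left := by
    change Etale (U.ι ≫ pullback.fst f.left g.left)
    exact MorphismProperty.comp_mem _ U.ι (pullback.fst f.left g.left) h2 h1
  have hinjT : ∀ R ∈ T, ∀ R' ∈ T, (ι R).1 = (ι R').1 → R = R' := by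
    intro R hR R' hR' h1
    apply hιemb.injective
    exact Prod.ext h1 (by rw [hR, hR', h1])
  have hbij : Function.Bijective (AlgPoints.map (L := ℂ) pZ) := by
    constructor
    · intro w w' hww'
      have hw : AlgPoints.map zι w ∈ T := by rw [hTV, ← hVrange]; exact ⟨w, rfl⟩
      have hw' : AlgPoints.map zι w' ∈ T := by rw [hTV, ← hVrange]; exact ⟨w', rfl⟩
      apply AlgPoints.map_injective zι
      refine hinjT _ hw _ hw' ?_
      change AlgPoints.map (pullbackOver.fst f g) (AlgPoints.map zι w) =
        AlgPoints.map (pullbackOver.fst f g) (AlgPoints.map zι w')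
      rw [← AlgPoints.map_comp_apply, ← AlgPoints.map_comp_apply]
      exact hww'
    · intro x
      have hx : s x ∈ Set.range (AlgPoints.map (L := ℂ) zι) := by
        rw [hVrange, ← hTV, hTrange]; exact ⟨x, rfl⟩
      obtain ⟨w, hw⟩ := hx
      refine ⟨w, ?_⟩
      rw [AlgPoints.map_comp_apply, hw]
      exact congrArg Prod.fst (hιs x)
  haveI : IsIso pZ := isIso_of_etale_of_bijective_map pZ hbij
  -- the algebraic lift
  refine ⟨inv pZ ≫ zι ≫ pullbackOver.snd f g, ?_, fun x => ?_⟩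
  · rw [Category.assoc, Category.assoc, ← pullbackOver.condition, ← Category.assoc zι,
      IsIso.inv_hom_id_assoc]
  · -- the `Z`-point over `x` corresponds to the point `s x ∈ T` of `C'''`
    set w := AlgPoints.map (L := ℂ) (inv pZ) x with hw
    have hpw : AlgPoints.map pZ w = x := by
      rw [hw, ← AlgPoints.map_comp_apply, IsIso.inv_hom_id, AlgPoints.map_id_apply]
    have hwT : AlgPoints.map zι w ∈ T := by rw [hTV, ← hVrange]; exact ⟨w, rfl⟩
    have h1 : (ι (AlgPoints.map zι w)).1 = x := by
      change AlgPoints.map (pullbackOver.fst f g) (AlgPoints.map zι w) = x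
      rw [← AlgPoints.map_comp_apply]
      exact hpw
    rw [AlgPoints.map_comp_apply, AlgPoints.map_comp_apply]
    change (ι (AlgPoints.map zι w)).2 = F x
    rw [hwT, h1]

end Literature.AlgebraicGeometry.Motives

end
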